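import Literature.Topology.FourManifolds.CircleProdSumAdditivity
import HarnessLib

/-!
# Summands of an orientable connected sum are orientable

Topic `Literature/Topology/FourManifolds`, companion of `ConnectedSum.lean` /
`CircleProdSumAdditivity.lean` (`IsConnectedSum.isOrientable_of_isOrientable`: a connected sum of
orientable manifolds is orientable).  This file proves the converse direction needed when the
conclusion of a classification theorem is propagated along a splitting `X = X₁ # X₂` of an
ORIENTED manifold whose pieces come without orientation data (e.g. the splitting facts
`Trisection.isConnectedSum_of_reducing_separating` in the inductive proof of Meier–Schirmer–Zupan's
Thm. 1.2, `LargeKTrisectionClassificationProofs.lean`):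

* `Literature.Topology.FourManifolds.isOrientable_of_puncture` — **an `n`-manifold, `n ≥ 2`, is
  orientable as soon as the complement of the centre of a disc `i : ℝⁿ ↪ M` is orientable**:
  glue (`SmoothOrientation.glue`, orientations form a sheaf) the given orientation of
  `M ∖ {i 0}` with the orientation of the coordinate patch `i(ℝⁿ)` transported from a constant
  orientation `o₀` of `ℝⁿ` (`SmoothOrientation.map`), `o₀` being chosen by Hirsch's dichotomy
  (`Diffeomorph.isOrientationPreserving_or_isOrientationReversing_holds`) on the CONNECTED
  punctured disc `ℝⁿ ∖ {0}` (`isConnected_compl_singleton_of_one_lt_rank`) so that the two agree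
  on the overlap `i(ℝⁿ ∖ {0})`.
* `Literature.Topology.FourManifolds.IsConnectedSum.isOrientable_left`,
  `Literature.Topology.FourManifolds.IsConnectedSum.isOrientable_right` — **if a connected sum
  `P = M # N` (the tree's relational `IsConnectedSum`, along arbitrary discs) is orientable, so are
  `M` and `N`** (`n ≥ 2`): `M ∖ {i₁ 0}` embeds openly in `P` (`jA`), so it inherits an orientation
  (`rangeDiffeomorph`, `SmoothOrientation.comap`), which extends over the centre by the previous
  lemma.  (Kosinski, *Differential Manifolds* (1993), VI §1: `M₁ # M₂` oriented iff both are;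
  Hirsch, *Differential Topology* (1976), §4.4.)

Everything is proved; no definition and no named fact is introduced.

## References

* A. Kosinski, *Differential Manifolds* (1993), Ch. VI §1, Thm. (1.1). [Kosinski1993]
* M. W. Hirsch, *Differential Topology*, GTM 33 (1976), Ch. 4 §4 (orientations of open subsets,
  the two orientations of a connected orientable manifold). [HirschDT1976]
-/

noncomputable section

open scoped Manifold ContDiff Topology
open Set Module Function Filter

namespace Literature.Topology.FourManifolds

universe u v w

/-! ### Extending an orientation over the centre of a disc -/

section Puncture

variable {n : ℕ} {M : Type u} [TopologicalSpace M] [T2Space M]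
  [ChartedSpace (EuclideanSpace ℝ (Fin n)) M] [IsManifold (𝓡 n) ∞ M]

/-- **An orientation of the complement of the centre of a disc extends over the centre**
(`n ≥ 2`).  Let `i : ℝⁿ → M` be a disc (a `C^∞` embedding of the model space; its range is open
by invariance of domain) and `oU` an orientation of the open submanifold `M ∖ {i 0}`.  Then `M`
is orientable.  Proof: on the connected punctured model space `ℝⁿ ∖ {0}` (`n ≥ 2`,
`isConnected_compl_singleton_of_one_lt_rank`) the disc is a diffeomorphism onto an open subset of
`M ∖ {i 0}`, hence preserves or reverses the orientations `(o, oU)` (Hirsch's dichotomy,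
`Diffeomorph.isOrientationPreserving_or_isOrientationReversing_holds`); choose the constant
orientation `o₀ = ±o` making it orientation preserving.  The coordinate patch `i(ℝⁿ)` carries the
orientation `oV` transported from `o₀` (`SmoothOrientation.map` along `rangeDiffeomorph`), for
which `i` is orientation preserving too; at a point `i v`, `v ≠ 0`, both `oU` and `oV` therefore
equal `o₀` exactly when `det dᵥi > 0` (in the preferred charts), so they agree on the overlap, and
`SmoothOrientation.glue` produces an orientation of `M = (M ∖ {i 0}) ∪ i(ℝⁿ)` (Hirsch 1976, §4.4;
Kosinski 1993, VI §1). [cite: HirschDT1976, Ch. 4 §4] -/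
theorem isOrientable_of_puncture (hn : 2 ≤ n) {i : EuclideanSpace ℝ (Fin n) → M}
    (hi : Manifold.IsSmoothEmbedding 𝓘(ℝ, EuclideanSpace ℝ (Fin n)) (𝓡 n) ∞ i)
    (oU : SmoothOrientation (𝓡 n) ↥(puncture i)) : IsOrientable (𝓡 n) M := by
  have hinf : (∞ : ℕ∞ω) ≠ 0 := by simp
  have hio : IsOpen (range i) := isOpen_range_of_isSmoothEmbedding_disc hi
  have hid : ∀ v, MDifferentiableAt 𝓘(ℝ, EuclideanSpace ℝ (Fin n)) (𝓡 n) i v := fun v =>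
    (hi.contMDiff v).mdifferentiableAt hinf
  -- the punctured model space `E₀ = ℝⁿ ∖ {0}`, connected since `n ≥ 2`
  let E₀ : TopologicalSpace.Opens (EuclideanSpace ℝ (Fin n)) := ⟨{0}ᶜ, isOpen_compl_singleton⟩
  have hE₀ : ∀ v : EuclideanSpace ℝ (Fin n), v ∈ E₀ ↔ v ≠ 0 := fun v => Iff.rfl
  haveI : ConnectedSpace ↥E₀ := by
    have h := isConnected_compl_singleton_of_one_lt_rank (E := EuclideanSpace ℝ (Fin n)) (by
      rw [← Module.finrank_eq_rank, finrank_euclideanSpace_fin]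
      exact_mod_cast hn) 0
    exact isConnected_iff_connectedSpace.mp h
  haveI : Nonempty ↥E₀ := inferInstance
  -- the disc restricted to `E₀`, as an open smooth embedding into `M ∖ {i 0}`
  have h0mem : ∀ v : ↥E₀, i v ∈ puncture i := fun v => by
    rw [mem_puncture]
    exact fun h => v.2 (hi.isEmbedding.injective h)
  let θ : ↥E₀ → ↥(puncture i) := fun v => ⟨i v, h0mem v⟩
  have hθ₀ : Manifold.IsSmoothEmbedding 𝓘(ℝ, EuclideanSpace ℝ (Fin n)) (𝓡 n) ∞
      (i ∘ (Subtype.val : ↥E₀ → EuclideanSpace ℝ (Fin n))) ∧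
      IsOpen (range (i ∘ (Subtype.val : ↥E₀ → EuclideanSpace ℝ (Fin n)))) :=
    isSmoothEmbedding_comp_of_isOpen_range hi hio (Manifold.IsSmoothEmbedding.of_opens E₀)
      (by rw [Subtype.range_coe]; exact E₀.isOpen) (ContinuousLinearEquiv.refl ℝ _)
  have hθ : Manifold.IsSmoothEmbedding 𝓘(ℝ, EuclideanSpace ℝ (Fin n)) (𝓡 n) ∞ θ ∧
      IsOpen (range θ) :=
    isSmoothEmbedding_comp_codRestrict hθ₀.1 hθ₀.2 (U := puncture i) (fun v => h0mem v)
      (ι := id) Manifold.IsSmoothEmbedding.id (by rw [range_id]; exact isOpen_univ)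
      (fun v => rfl)
  -- Hirsch's dichotomy on the connected `E₀`: choose `o₀` making `θ` orientation preserving
  obtain ⟨o⟩ := nonempty_orientation (EuclideanSpace ℝ (Fin n))
  set ρ := rangeDiffeomorph hθ.1 hθ.2 with hρ
  have hρθ : ∀ v, ((ρ v : ↥(rangeOpens θ hθ.2)) : ↥(puncture i)) = θ v := fun v => rfl
  have hθd : ∀ v, MDifferentiableAt 𝓘(ℝ, EuclideanSpace ℝ (Fin n)) (𝓡 n) θ v := fun v =>
    (hθ.1.contMDiff v).mdifferentiableAt hinf
  have hdρ : ∀ v : ↥E₀, mfderiv 𝓘(ℝ, EuclideanSpace ℝ (Fin n)) (𝓡 n) ρ v =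
      mfderiv 𝓘(ℝ, EuclideanSpace ℝ (Fin n)) (𝓡 n) i (v : EuclideanSpace ℝ (Fin n)) := fun v => by
    rw [mfderiv_codRestrict_opens_eq hρθ (hθd v)]
    exact mfderiv_opens_eq (f := i) (g := θ) (fun y => rfl) (hid _)
  obtain ⟨o₀, hpres⟩ : ∃ o₀ : Orientation ℝ (EuclideanSpace ℝ (Fin n))
      (Fin (finrank ℝ (EuclideanSpace ℝ (Fin n)))),
      IsOrientationPreserving ((SmoothOrientation.modelSpace o₀).restrict E₀)
        (oU.restrict (rangeOpens θ hθ.2)) ρ := by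
    rcases Diffeomorph.isOrientationPreserving_or_isOrientationReversing_holds ρ hinf
      ((SmoothOrientation.modelSpace o).restrict E₀) (oU.restrict (rangeOpens θ hθ.2)) with h | h
    · exact ⟨o, h⟩
    · refine ⟨-o, ?_⟩
      rw [← SmoothOrientation.neg_modelSpace, SmoothOrientation.restrict_neg,
        ← isOrientationReversing_iff_neg]
      exact h
  -- (B) on the overlap, `oU (i v) = o₀ ↔ det dᵥi > 0`
  have hB : ∀ v : ↥E₀, oU (θ v) = o₀ ↔ 0 < LinearMap.det (M := EuclideanSpace ℝ (Fin n))
      (mfderiv 𝓘(ℝ, EuclideanSpace ℝ (Fin n)) (𝓡 n) i (v : EuclideanSpace ℝ (Fin n))).toLinearMap := by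
    intro v
    have h := hpres v
    rw [SmoothOrientation.restrict_apply, SmoothOrientation.restrict_apply,
      SmoothOrientation.modelSpace_apply, hdρ v] at h
    exact h
  -- the coordinate patch `V = i(ℝⁿ)` with the transported orientation
  set φ := rangeDiffeomorph hi hio with hφ
  have hφi : ∀ v, ((φ v : ↥(rangeOpens i hio)) : M) = i v := fun v => rfl
  have hdφ : ∀ v, mfderiv 𝓘(ℝ, EuclideanSpace ℝ (Fin n)) (𝓡 n) φ v =
      mfderiv 𝓘(ℝ, EuclideanSpace ℝ (Fin n)) (𝓡 n) i v := fun v =>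
    mfderiv_codRestrict_opens_eq hφi (hid v)
  set oV : SmoothOrientation (𝓡 n) ↥(rangeOpens i hio) :=
    (SmoothOrientation.modelSpace o₀).map φ hinf with hoV
  -- (A) on the patch, `oV (i v) = o₀ ↔ det dᵥi > 0`
  have hA : ∀ v, oV (φ v) = o₀ ↔ 0 < LinearMap.det (M := EuclideanSpace ℝ (Fin n))
      (mfderiv 𝓘(ℝ, EuclideanSpace ℝ (Fin n)) (𝓡 n) i v).toLinearMap := by
    intro v
    have h := SmoothOrientation.isOrientationPreserving_map (SmoothOrientation.modelSpace o₀) φ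
      hinf v
    rw [SmoothOrientation.modelSpace_apply, hdφ v] at h
    exact h
  -- glue
  have hcard : Fintype.card (Fin (finrank ℝ (EuclideanSpace ℝ (Fin n)))) =
      finrank ℝ (EuclideanSpace ℝ (Fin n)) := Fintype.card_fin _
  refine ⟨SmoothOrientation.glue (puncture i) (rangeOpens i hio) oU oV (fun x => ?_)
    (fun x hU hV => ?_)⟩
  · by_cases hx : x = i 0
    · exact Or.inr ⟨0, hx.symm⟩
    · exact Or.inl hx
  · obtain ⟨v, rfl⟩ : x ∈ range i := hV
    have hv : v ≠ 0 := fun h => hU (by rw [h]; exact mem_singleton _)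
    suffices key : ∀ (p : i v ∈ puncture i) (q : i v ∈ rangeOpens i hio),
        oU ⟨i v, p⟩ = oV ⟨i v, q⟩ from key _ _
    intro p q
    have h1 : oU ⟨i v, p⟩ = oU (θ ⟨v, hv⟩) := rfl
    have h2 : oV ⟨i v, q⟩ = oV (φ v) := rfl
    rw [h1, h2]
    by_cases hd : 0 < LinearMap.det (M := EuclideanSpace ℝ (Fin n))
        (mfderiv 𝓘(ℝ, EuclideanSpace ℝ (Fin n)) (𝓡 n) i v).toLinearMap
    · rw [(hB ⟨v, hv⟩).2 hd, (hA v).2 hd]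
    · have hU' : oU (θ ⟨v, hv⟩) = -o₀ :=
        ((oU (θ ⟨v, hv⟩)).eq_or_eq_neg o₀ hcard).resolve_left fun h => hd ((hB ⟨v, hv⟩).1 h)
      have hV' : oV (φ v) = -o₀ :=
        ((oV (φ v)).eq_or_eq_neg o₀ hcard).resolve_left fun h => hd ((hA v).1 h)
      rw [hU', hV']

end Puncture

/-! ### Summands of an orientable connected sum -/

section Summand

variable {n : ℕ} {M : Type u} [TopologicalSpace M] [T2Space M]
  [ChartedSpace (EuclideanSpace ℝ (Fin n)) M] [IsManifold (𝓡 n) ∞ M]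
  {EN HN : Type*} [NormedAddCommGroup EN] [NormedSpace ℝ EN] [TopologicalSpace HN]
  {IN : ModelWithCorners ℝ EN HN}
  {N : Type v} [TopologicalSpace N] [T2Space N] [ChartedSpace HN N]
  {P : Type w} [TopologicalSpace P] [ChartedSpace (EuclideanSpace ℝ (Fin n)) P]
  [IsManifold (𝓡 n) ∞ P]

/-- **The first summand of an orientable connected sum is orientable** (`n ≥ 2`; the second
summand `N` may have any model).  If `P` is a connected sum `M # N` — an open gluing of
`M ∖ {i₁ 0}` and a punctured `N` — and `P` carries an orientation `oP`, then `M ∖ {i₁ 0}` is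
diffeomorphic to its open image `jA(M ∖ {i₁ 0}) ⊆ P` (`rangeDiffeomorph`) and inherits the
orientation `oP` (`SmoothOrientation.comap` of the restriction), which extends over the centre
of the disc `i₁` (`isOrientable_of_puncture`).  (Kosinski 1993, VI §1, Thm. (1.1): `M₁ # M₂` is
oriented iff `M₁`, `M₂` are; Hirsch 1976, §4.4.) [cite: Kosinski1993, Ch. VI §1, Thm (1.1)]
[cite: HirschDT1976, Ch. 4 §4] -/
theorem IsConnectedSum.isOrientable_left (hn : 2 ≤ n) (h : IsConnectedSum (𝓡 n) (𝓡 n) IN M N P)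
    (hP : IsOrientable (𝓡 n) P) : IsOrientable (𝓡 n) M := by
  obtain ⟨i₁, i₂, hi₁, -, jA, jB, hA, hAo, -, -, -, -⟩ := h
  obtain ⟨oP⟩ := hP
  have hinf : (∞ : ℕ∞ω) ≠ 0 := by simp
  let ψ := rangeDiffeomorph hA hAo
  exact isOrientable_of_puncture hn hi₁ ((oP.restrict (rangeOpens jA hAo)).comap ψ hinf)

end Summand

section SummandRight

variable {n : ℕ} {N : Type u} [TopologicalSpace N] [T2Space N]
  [ChartedSpace (EuclideanSpace ℝ (Fin n)) N] [IsManifold (𝓡 n) ∞ N]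
  {EM HM : Type*} [NormedAddCommGroup EM] [NormedSpace ℝ EM] [TopologicalSpace HM]
  {IM : ModelWithCorners ℝ EM HM}
  {M : Type v} [TopologicalSpace M] [T2Space M] [ChartedSpace HM M]
  {P : Type w} [TopologicalSpace P] [ChartedSpace (EuclideanSpace ℝ (Fin n)) P]
  [IsManifold (𝓡 n) ∞ P]

/-- **The second summand of an orientable connected sum is orientable** (`n ≥ 2`; the first
summand may have any model): by the symmetry of the connected sum relation
(`IsConnectedSum.symm`) and `IsConnectedSum.isOrientable_left`.
[cite: Kosinski1993, Ch. VI §1, Thm (1.1)] -/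
theorem IsConnectedSum.isOrientable_right (hn : 2 ≤ n) (h : IsConnectedSum (𝓡 n) IM (𝓡 n) M N P)
    (hP : IsOrientable (𝓡 n) P) : IsOrientable (𝓡 n) N :=
  h.symm.isOrientable_left hn hP

end SummandRight

end Literature.Topology.FourManifolds

end
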